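import Literature.MathematicalPhysics.QuantumFieldTheory.Balaban1983to89.B9DivViaGradLettersAtPins

/-!
# `Balaban1983to89.B9CoReadingCoordsInputExpMono` — [Balaban1985BackgroundPropagators] (3.39)–(3.41), (3.44)–(3.45) pp. 397–398; [Balaban1984PropagatorsII] (2.51)–(2.52) p. 232,
# (2.137) p. 247: THE BOND INPUT NORM `bHK` IS MONOTONE IN THE HÖLDER EXPONENT — `(bHK ε).loc ≤ (bHK ε′).loc` for `0 < ε ≤ ε′` (admissible pairs have `t ≤ 1`),
# so a member OUT OF `bHK ε` is a member OUT OF `bHK ε′`: the bond twin of `B9CoReadingCoordsInputSLoc.hasMaj_bHS_of_le`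

T. Bałaban, *Propagators for lattice gauge theories in a background field*, Commun. Math. Phys. **99** (1985) 389–434 [`Balaban1985BackgroundPropagators`];
[4] = T. Bałaban, *Propagators and renormalization transformations for lattice gauge theories. II*, Commun. Math. Phys. **96** (1984) 223–250 [`Balaban1984PropagatorsII`].
statement-level skeleton of published theorems with citation tags; proofs where landed; nothing here is a claim about the Yang–Mills mass gap.

THE PRINT.  (3.40)–(3.41) p. 397: the Hölder quotient with weight `|x − x′|^{−α}` over pairs at distance at most the block scale; (3.44)–(3.45) p. 398: the input functional
`‖λ‖^{ξ′}_{ε} + |λ|` resp. `‖λ‖^{ξ′}_{β+ε} + |λ|` — Theorem 3.3's members are stated for `0 < ε ≦ 1`, while the (3.45) chain of Theorem 3.13 reads its input at `β + ε` (up to 2).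

WHY THIS FILE (cell `pub-ymgap`, node N06, bundle F7 rows 20–21, seat dag-n06-l g32; programme P-HRGDD leg (D)'s source side).  The certificate's bond input class is the FLAT
`bHXA x = bHK (bI x)` (`B9CoReadingCoordsInput`): `loc y F = supK y F + holK ε y F`, the Hölder part weighted by `t^{−ε}` over ADMISSIBLE bond pairs, and admissible pairs
have `0 ≤ t ≤ 1` (`B6KLevelCensusIndexV1.tpar_nonneg ∕ tpar_le_one`), so `t^{−ε} ≤ t^{−ε′}` for `0 < ε ≤ ε′`: the class size GROWS with the exponent and a majorant of `T` out of
`bHK ε` is the same majorant out of `bHK ε′` (the source norm only got larger).  This is how leg (D) of P-HRGDD reads leg (A)'s (3.44)-type member `∇_νG₁∇\*_μ : bHK ε → ofBlocks`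
(Theorem 3.3's range `0 < ε ≦ 1`, `B9Thm313WholeG1PairMembersRegular.g1Pair_members_of_stateS` (iii)) at the (3.45) chain's source exponents `β + ε > 1`: at `min (β+ε) 1`, then
climb.  The site twin (`bHS`, factor 3 because its pair set is not capped at the block scale) is `B9CoReadingCoordsInputSLoc.hasMaj_bHS_of_le` (dag-n06-d's U8 producers).
* ★ `bHK_loc_mono` (from `B9DivViaGradLettersAtPins.holK_mono` — the Hölder part's growth, typed there for `bHK_dom`, the `1 ≤ ε` comparison of `h44Ds_of_h44m`),
  ★★ `hasMaj_bHK_of_le` (factor 1, any `0 < ε ≤ ε′`), `bHK_isLoc_iff_of_exp` (the localisation does not depend on ε — `Iff.rfl`).  (The same file types the coordinate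
  identity `DvscoKH = Σ_ν JTcoKH ν ∘ Dd ν` — `D\*_U = Σ_ν J†_ν ∘ ∇_{U,ν}` — that leg (D) uses to split `R∘D\*∘G₁∘∇\*_μ` direction by direction.)
HONEST SCOPE.  Bookkeeping over landed definitions; nothing of [B9]∕[4] asserted; no pin, no certificate edit; COUNT-NEUTRAL; N06 NOT discharged; nothing continuum ∕ OS ∕
mass gap ∕ Clay.  NEW file; cell `pub-ymgap` (HUMAN RULING D-0062), Track A node N06 [B9], seat `pub-ymgap-dag-n06-l` (g32), 2026-08-30.
-/

namespace Literature.MathematicalPhysics.QuantumFieldTheory.Balaban1983to89.B9CoReadingCoordsInputExpMono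

open B6KLevelCensusIndexV1 (KIdx)
open B9GeoNormsKLevelV1 (geo9K)
open B9Thm34Ext (toB6)
open B11SectG (BlockNorm HasMaj)
open B9CoReadingCoords (XBK blkBK)
open B9CoRealizesRelAtLetters (RelB)
open B9CoReadingCoordsInput (bHK supK holK)
open B9DivViaGradLettersAtPins (holK_mono bHK_dom)
open Node00 (FBondY IBondY)

noncomputable section

variable {d ℓ : ℕ} {hd : 1 ≤ d + 1} {hL : Odd (ℓ + 1) ∧ 1 < ℓ + 1} {b₀ b₁ : ℝ}
variable {κ : Type} [Fintype κ]
variable (i : KIdx d ℓ hd hL b₀ b₁) [Fintype (geo9K i).Site] [DecidableRel (RelB i)] (bI : FBondY i → IBondY i) {R : ℝ} {H : Prop}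

/-- ★ **THE BOND INPUT NORM GROWS WITH THE EXPONENT**: `(bHK ε).loc y F ≤ (bHK ε′).loc y F` for `0 < ε ≤ ε′`.
[cite: Balaban1985BackgroundPropagators, (3.39)–(3.41) p.397 + (3.44) p.398 (bookkeeping)] -/
theorem bHK_loc_mono {ε ε' : ℝ} (hε : 0 < ε) (hεε' : ε ≤ ε') (y : IBondY i) (F : XBK κ i → ℝ) :
    (bHK i bI ε (R := R) (H := H)).loc y F ≤ (bHK i bI ε' (R := R) (H := H)).loc y F := by
  show supK i bI y F + holK i bI ε y F ≤ supK i bI y F + holK i bI ε' y F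
  exact add_le_add le_rfl (holK_mono i hε hεε' y F)

/-- the localisation of `bHK ε` does not depend on `ε`. [cite: Balaban1985BackgroundPropagators, (3.44) p.398, bookkeeping] -/
theorem bHK_isLoc_iff_of_exp (ε ε' : ℝ) (y : IBondY i) (F : XBK κ i → ℝ) :
    (bHK i bI ε (R := R) (H := H)).IsLoc y F ↔ (bHK i bI ε' (R := R) (H := H)).IsLoc y F := Iff.rfl

/-- ★★ **A MEMBER OUT OF `bHK ε` IS A MEMBER OUT OF `bHK ε′` FOR `0 < ε ≤ ε′`** with the SAME (non-negative) majorant — how a consumer reads Theorem 3.3's `0 < ε ≦ 1` members at the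
(3.45) chain's source exponents above 1 (at `min ε 1`, then climb). [cite: Balaban1985BackgroundPropagators, (3.44)–(3.45) p.398 (bookkeeping); Balaban1984PropagatorsII, (2.51)–(2.52) p.232] -/
theorem hasMaj_bHK_of_le {F₂ : Type} [AddCommGroup F₂] [Module ℝ F₂] {b₂ : BlockNorm (toB6 (geo9K i) R H) F₂} {T : (XBK κ i → ℝ) →ₗ[ℝ] F₂}
    {K : IBondY i → IBondY i → ℝ} (hK : ∀ a c, 0 ≤ K a c) {ε ε' : ℝ} (hε : 0 < ε) (hεε' : ε ≤ ε')
    (h : HasMaj (bHK i bI ε (R := R) (H := H)) b₂ T K) :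
    HasMaj (bHK i bI ε' (R := R) (H := H)) b₂ T K := fun y' μ hμ y =>
  calc b₂.loc y (T μ) ≤ K y y' * (bHK i bI ε (R := R) (H := H)).loc y' μ := h y' μ hμ y
    _ ≤ K y y' * (bHK i bI ε' (R := R) (H := H)).loc y' μ := mul_le_mul_of_nonneg_left (bHK_loc_mono i bI hε hεε' y' μ) (hK y y')

end

end Literature.MathematicalPhysics.QuantumFieldTheory.Balaban1983to89.B9CoReadingCoordsInputExpMono
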